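import Summits.CriticalPhenomena.PercolationContinuityZ3.Theorems.PercNearOneGluingNoHeavyLowerTailCubicThreePointFibreTheta
import Summits.CriticalPhenomena.PercolationContinuityZ3.Theorems.PercNearOneGluingNoHeavyLowerTailCubicThreePointChordStep
import Summits.CriticalPhenomena.PercolationContinuityZ3.Theorems.PercNearOneGluingNoHeavyLowerTailCubicThreePointGluingMeasure
import Mathlib.Data.Finset.Sym
import HarnessLib

/-!
# `NoHeavyLowerTail` (stmt-CriticalPhenomena-4575) — Sahi's C₃ on the pairwise separations (SHK3⁺) for EVERY weighted graph on five vertices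

Support file (prover prim-sahi-p2; `--supports stmt-CriticalPhenomena-4575`).  Assembly: `Sym2 (Fin 5)` = theta graph `Θ` + the three terminal
chords + five loops (`univ_sym2_fin5_eq`); SHK3⁺ for all weights on `Θ` is the certificate `shk3W_theta_nonneg` (`…FibreTheta`, via the fibre
criterion `…FibreCriterion/Table/Mask`); terminal chords preserve SHK3⁺ (`shk3W_insert_ab/ac/bc_nonneg`, `…ChordStep` = THEOREM A with
`AG ≥ 0` automatic) and loops change nothing (`shk3W_insert_loop`); the bridge `sahiE3_pairSep_nonneg_of_F` (`…GluingMeasure`) converts to Sahi's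
`E₃` under `prodBernoulli`.  RESULTS: `shk3W_univ_fin5_nonneg` and `sahiE3_pairSep_nonneg_fin5 (w : Sym2 (Fin 5) → [0,1]) :
0 ≤ E₃({0≁1},{0≁2},{1≁2})` — every weighted graph on ≤ 5 vertices (smaller graphs and other terminal triples embed by zero weights and relabelling);
this extends `sahiE3_pairSep_nonneg_fin4` and `…_fin5_of_hubEdge_zero` (`…GluingSmallGraphs`) to the full five-vertex case, whose only non-series-parallel
core is `Θ`.  [cite: LiebSahi2021, eq. (2.1), Conj. 1.1]; [cite: Gladkov2024StrongFKG, Cor. 4.2]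
-/

noncomputable section

namespace Summit.CriticalPhenomena.PercolationContinuityZ3.Theorems

namespace TerminalGluing

open Finset SimpleGraph Literature.Probability.Percolation Literature.Probability.Percolation.DecisionTree
open CubicThreePointStep CubicThreePointTerminal

/-! ### All weighted graphs on five vertices -/

section Fin5

open MeasureTheory Literature.Probability.LatticeModels in
/-- `Sym2 (Fin 5)` is the ten edges of `K₅` (theta graph plus the three terminal chords) plus the five loops. [folklore] -/
theorem univ_sym2_fin5_eq : (Finset.univ : Finset (Sym2 (Fin 5))) =
    insert s(0, 0) (insert s(1, 1) (insert s(2, 2) (insert s(3, 3) (insert s(4, 4)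
      (insert s(0, 1) (insert s(0, 2) (insert s(1, 2) thetaD))))))) := by
  decide

/-- **SHK3⁺ for every weighting of `K₅`** (terminals `0,1,2`; loops carry arbitrary irrelevant weights): theta certificate plus three
terminal chords (THEOREM A) plus five loops. [cite: Gladkov2024StrongFKG, Cor. 4.2] -/
theorem shk3W_univ_fin5_nonneg (p : Sym2 (Fin 5) → ℝ) (hp0 : ∀ e, 0 ≤ p e) (hp1 : ∀ e, p e ≤ 1) :
    0 ≤ shk3W (Finset.univ : Finset (Sym2 (Fin 5))) p ∅ (0 : Fin 5) 1 2 := by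
  rw [univ_sym2_fin5_eq]
  simp (disch := decide) only [shk3W_insert_loop]
  refine shk3W_insert_ab_nonneg (insert s(0, 2) (insert s(1, 2) thetaD)) hp0 hp1 ∅ 2 (by decide) (by decide) ?_
  refine shk3W_insert_ac_nonneg (insert s(1, 2) thetaD) hp0 hp1 ∅ 2 (by decide) (by decide) ?_
  refine shk3W_insert_bc_nonneg thetaD hp0 hp1 ∅ 2 (by decide) (by decide) ?_
  exact shk3W_theta_nonneg p hp0 hp1

open MeasureTheory Literature.Probability.LatticeModels in
/-- **Sahi's C₃ instance on the pairwise separations holds for every weighted graph on five vertices**: for every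
`w : Sym2 (Fin 5) → [0,1]`, `0 ≤ E₃({0≁1},{0≁2},{1≁2})` under `prodBernoulli w` (every graph on ≤ 5 vertices with any three terminals
embeds by zero weights and relabelling). [cite: LiebSahi2021, eq. (2.1) and Conj. 1.1 (here a theorem for |V| ≤ 5)] -/
theorem sahiE3_pairSep_nonneg_fin5 (w : Sym2 (Fin 5) → unitInterval) :
    0 ≤ sahiE3 (prodBernoulli w) (openConn (0 : Fin 5) 1)ᶜ (openConn (0 : Fin 5) 2)ᶜ (openConn (1 : Fin 5) 2)ᶜ :=
  sahiE3_pairSep_nonneg_of_F w 0 1 2 Finset.univ (fun e he => absurd (Finset.mem_univ e) he)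
    (shk3W_univ_fin5_nonneg _ (fun e => unitInterval.nonneg (w e)) (fun e => unitInterval.le_one (w e)))

end Fin5

end TerminalGluing

end Summit.CriticalPhenomena.PercolationContinuityZ3.Theorems
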